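import Summits.KontsevichZagierPeriods.KontsevichZagierPeriods.Theses.HurwitzMicroSectors
import Summits.KontsevichZagierPeriods.KontsevichZagierPeriods.Theorems.HurwitzMicroSectorsNormalFormPrinciplePiBoxTransfer
import Summits.KontsevichZagierPeriods.KontsevichZagierPeriods.Theorems.HurwitzMicroSectorsNormalFormPrincipleVariants2284
import Summits.KontsevichZagierPeriods.KontsevichZagierPeriods.Theorems.HurwitzMicroSectorsNormalFormPrincipleVariants2285

/-! TTRL-lite variant V2288 of stmt-KontsevichZagierPeriods-3869

Variant V2288 = `stub_boxRigidity` (the leaf `BoxRigidity` of `NormalFormPrinciple`: two BOX-RATIONAL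
representations — domain the open unit box, integrand `p/q` over `ℚ`, `q ≠ 0` on the box — with equal
values are KZ-equivalent) under the two-sided move `bound_nat:m≤5; bound_nat:m'≤3`. Verdict of the
attempt seat: **open** — this file is the exact-strength certificate, not a proof of the variant. With
`BoxVanishing K` := "every box-rational representation of dimension `K` and value `0` is a relation":
* `V2288 ⟹ V2285` (the sibling `m ≤ 5; m' ≤ 2`, trivially: `m' ≤ 2 → m' ≤ 3`,
  `stub_boxRigidity_var2285_of_stub_boxRigidity_var2288`), and `V2285 ⟹ BoxVanishing 5` (tree, file
  `…Variants2285`: `m = 5`, `m' = 0`, compare with the zero representation on the `0`-box), whence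
  `boxVanishing_five_of_stub_boxRigidity_var2288`;
* `BoxVanishing 5 ⟹ BoxRigidity for all m, m' ≤ 5` (`boxRigidityLe_five_of_boxVanishing_five`, tree, file
  `…Variants2284`: pad both representations to the `5`-box by unit intervals — Newton–Leibniz moves,
  `pad_le` — and subtract on the common box, `sub_same`; the difference has value `0` by soundness);
* hence `V2288 ⟺ BoxVanishing 5 ⟺ BoxRigidity(m, m' ≤ 5) ⟺ V2285 ⟺ V2284`
  (`stub_boxRigidity_var2288_iff_boxVanishing_five`, `…_iff_le_five`, `…_iff_var2285`, `…_iff_var2284`):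
  the bound `m' ≤ 3` is idle — the strength of a two-sided sibling is determined by its LARGEST
  admissible dimension alone (here `5`);
* `KontsevichZagierPeriods ⟹ parent leaf ⟹ V2288` (`stub_boxRigidity_var2288_of_statement`,
  `stub_boxRigidity_var2288_of_parent`), so a refutation of V2288 would refute the Summit; the tree has no
  invariant of `KZ.relations` finer than `eval` (soundness) with which to attempt one
  (`KZSubcalculusInvariants` only separates proper sub-calculi).
Why open: `BoxVanishing 5 ⟹ BoxVanishing 2` (`boxVanishing_le_five_of_stub_boxRigidity_var2288`), which
asserts that every vanishing absolutely convergent `∫∫_{(0,1)²} p/q` (`p, q ∈ ℚ[x,y]`, `q ≠ 0` on the open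
square) is generated by the four moves; for the family `[(0,1)², 1/(1+x²y²) − c]` of value `G − c`
(`G` = Catalan's constant, `c : ℚ`) the side conditions of every move are sentences of the theory of real
closed fields in the parameter `c`, independent of the value, and a chain at `c` forces `G = c` by
soundness; two distinct `c` cannot both carry chains, so a proof must refute `G = c` for all rationals `c`
but at most one explicit `c₀` — an irrationality(-type) theorem for `G`, open. The tree's knowledge stops
at `m, m' ≤ 1` (`boxRigidity_of_le_one`, Baker, file `…BoxRigidityDimOne`). Residual goal: `BoxVanishing 5`.
Source: M. Kontsevich, D. Zagier, *Periods* (2001), §1.2 Conjecture 1 and rules 1)–3).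
Pure proof file, no definitions. -/

-- `Summit.<Summit>.<Problem>` is the tree's mandated summit-side namespace (CONVENTIONS §2); for this
-- single-conjunct summit the two coincide, so the duplicate is deliberate.
set_option linter.dupNamespace false

noncomputable section

namespace Summit.KontsevichZagierPeriods.KontsevichZagierPeriods.Theorems

open MeasureTheory Set
open Literature.NumberTheory.Transcendental Literature.NumberTheory.Transcendental.KZ
open Summit.KontsevichZagierPeriods.KontsevichZagierPeriods.Theses.HurwitzMicroSectors
open Summit.KontsevichZagierPeriods.HurwitzMicroSectors.NormalFormPrinciple.PiBox

/-! ## V2288 ⇒ V2285 ⇒ `BoxVanishing 5` -/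

/-- **V2288 ⇒ V2285**: the sibling with `m' ≤ 2` in place of `m' ≤ 3` is a special case.
[cite: KontsevichZagier2001, §1.2 Conjecture 1] -/
theorem stub_boxRigidity_var2285_of_stub_boxRigidity_var2288
    (h : ∀ (m m' : ℕ) (N : IntegralRep m) (N' : IntegralRep m'), m' ≤ 3 → m ≤ 5 → N.domain = {x | ∀ i, x i ∈ Set.Ioo (0:ℝ) 1} → N.IsRational → N'.domain = {x | ∀ i, x i ∈ Set.Ioo (0:ℝ) 1} → N'.IsRational → N.value = N'.value → Equivalent N N') :
    ∀ (m m' : ℕ) (N : IntegralRep m) (N' : IntegralRep m'), m' ≤ 2 → m ≤ 5 → N.domain = {x | ∀ i, x i ∈ Set.Ioo (0:ℝ) 1} → N.IsRational → N'.domain = {x | ∀ i, x i ∈ Set.Ioo (0:ℝ) 1} → N'.IsRational → N.value = N'.value → Equivalent N N' :=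
  fun m m' N N' hm' hm => h m m' N N' (hm'.trans (by norm_num)) hm

/-- **V2288 ⇒ `BoxVanishing 5`**: a box-rational `N : IntegralRep 5` of value `0` is a relation (via
V2285: compare with the zero representation on the `0`-box). [cite: KontsevichZagier2001, §1.2 Conjecture 1] -/
theorem boxVanishing_five_of_stub_boxRigidity_var2288
    (h : ∀ (m m' : ℕ) (N : IntegralRep m) (N' : IntegralRep m'), m' ≤ 3 → m ≤ 5 → N.domain = {x | ∀ i, x i ∈ Set.Ioo (0:ℝ) 1} → N.IsRational → N'.domain = {x | ∀ i, x i ∈ Set.Ioo (0:ℝ) 1} → N'.IsRational → N.value = N'.value → Equivalent N N')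
    (N : IntegralRep 5) (hNd : N.domain = {x | ∀ i, x i ∈ Set.Ioo (0:ℝ) 1}) (hNr : N.IsRational)
    (hv : N.value = 0) : of N ∈ relations :=
  boxVanishing_five_of_stub_boxRigidity_var2285
    (stub_boxRigidity_var2285_of_stub_boxRigidity_var2288 h) N hNd hNr hv

/-! ## The variant V2288 itself: exactly `BoxVanishing 5` -/

/-- **V2288 ⟺ `BoxVanishing 5`** — the exact strength of the variant: Conjecture 1 for box-rational
periods of dimension `≤ 5`. (⇐) pads both representations to the `5`-box and subtracts there
(`boxRigidityLe_five_of_boxVanishing_five`). [cite: KontsevichZagier2001, §1.2 Conjecture 1] -/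
theorem stub_boxRigidity_var2288_iff_boxVanishing_five :
    (∀ (m m' : ℕ) (N : IntegralRep m) (N' : IntegralRep m'), m' ≤ 3 → m ≤ 5 → N.domain = {x | ∀ i, x i ∈ Set.Ioo (0:ℝ) 1} → N.IsRational → N'.domain = {x | ∀ i, x i ∈ Set.Ioo (0:ℝ) 1} → N'.IsRational → N.value = N'.value → Equivalent N N') ↔
    (∀ (M : IntegralRep 5), M.domain = {x | ∀ i, x i ∈ Set.Ioo (0:ℝ) 1} → M.IsRational →
      M.value = 0 → of M ∈ relations) :=
  ⟨boxVanishing_five_of_stub_boxRigidity_var2288,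
    fun hvan m m' N N' hm' hm =>
      boxRigidityLe_five_of_boxVanishing_five hvan m m' N N' hm (hm'.trans (by norm_num))⟩

/-- **V2288 ⟺ `BoxRigidity` for all `m, m' ≤ 5`**: the bound `m' ≤ 3` is idle; V2288 coincides with
every two-sided sibling of maximal dimension `5`. [cite: KontsevichZagier2001, §1.2 Conjecture 1] -/
theorem stub_boxRigidity_var2288_iff_le_five :
    (∀ (m m' : ℕ) (N : IntegralRep m) (N' : IntegralRep m'), m' ≤ 3 → m ≤ 5 → N.domain = {x | ∀ i, x i ∈ Set.Ioo (0:ℝ) 1} → N.IsRational → N'.domain = {x | ∀ i, x i ∈ Set.Ioo (0:ℝ) 1} → N'.IsRational → N.value = N'.value → Equivalent N N') ↔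
    (∀ (m m' : ℕ) (N : IntegralRep m) (N' : IntegralRep m'), m ≤ 5 → m' ≤ 5 →
      N.domain = {x | ∀ i, x i ∈ Set.Ioo (0:ℝ) 1} → N.IsRational →
      N'.domain = {x | ∀ i, x i ∈ Set.Ioo (0:ℝ) 1} → N'.IsRational →
      N.value = N'.value → Equivalent N N') := by
  rw [stub_boxRigidity_var2288_iff_boxVanishing_five, ← stub_boxRigidity_var2284_iff_boxVanishing_five]
  exact stub_boxRigidity_var2284_iff_le_five

/-- **V2288 ⟺ V2285** (`bound_nat:m≤5; bound_nat:m'≤2`): both are `BoxVanishing 5`.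
[cite: KontsevichZagier2001, §1.2 Conjecture 1] -/
theorem stub_boxRigidity_var2288_iff_var2285 :
    (∀ (m m' : ℕ) (N : IntegralRep m) (N' : IntegralRep m'), m' ≤ 3 → m ≤ 5 → N.domain = {x | ∀ i, x i ∈ Set.Ioo (0:ℝ) 1} → N.IsRational → N'.domain = {x | ∀ i, x i ∈ Set.Ioo (0:ℝ) 1} → N'.IsRational → N.value = N'.value → Equivalent N N') ↔
    (∀ (m m' : ℕ) (N : IntegralRep m) (N' : IntegralRep m'), m' ≤ 2 → m ≤ 5 → N.domain = {x | ∀ i, x i ∈ Set.Ioo (0:ℝ) 1} → N.IsRational → N'.domain = {x | ∀ i, x i ∈ Set.Ioo (0:ℝ) 1} → N'.IsRational → N.value = N'.value → Equivalent N N') := by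
  rw [stub_boxRigidity_var2288_iff_boxVanishing_five, stub_boxRigidity_var2285_iff_boxVanishing_five]

/-- **V2288 ⟺ V2284** (`fix_nat:m=5; bound_nat:m'≤2`): both are `BoxVanishing 5`.
[cite: KontsevichZagier2001, §1.2 Conjecture 1] -/
theorem stub_boxRigidity_var2288_iff_var2284 :
    (∀ (m m' : ℕ) (N : IntegralRep m) (N' : IntegralRep m'), m' ≤ 3 → m ≤ 5 → N.domain = {x | ∀ i, x i ∈ Set.Ioo (0:ℝ) 1} → N.IsRational → N'.domain = {x | ∀ i, x i ∈ Set.Ioo (0:ℝ) 1} → N'.IsRational → N.value = N'.value → Equivalent N N') ↔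
    (∀ (m' : ℕ) (N : IntegralRep 5) (N' : IntegralRep m'), m' ≤ 2 → N.domain = {x | ∀ i, x i ∈ Set.Ioo (0:ℝ) 1} → N.IsRational → N'.domain = {x | ∀ i, x i ∈ Set.Ioo (0:ℝ) 1} → N'.IsRational → N.value = N'.value → Equivalent N N') := by
  rw [stub_boxRigidity_var2288_iff_boxVanishing_five, stub_boxRigidity_var2284_iff_boxVanishing_five]

/-- **V2288 ⇒ `BoxVanishing` in every dimension `≤ 5`**, in particular the dimension-`2` statement that
every vanishing `ℚ`-combination of absolutely convergent `∫_{(0,1)²} p/q` is generated by the moves — the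
first open dimension (it contains the Catalan family `[(0,1)², 1/(1+x²y²) − c]`).
[cite: KontsevichZagier2001, §1.2 Conjecture 1] -/
theorem boxVanishing_le_five_of_stub_boxRigidity_var2288
    (h : ∀ (m m' : ℕ) (N : IntegralRep m) (N' : IntegralRep m'), m' ≤ 3 → m ≤ 5 → N.domain = {x | ∀ i, x i ∈ Set.Ioo (0:ℝ) 1} → N.IsRational → N'.domain = {x | ∀ i, x i ∈ Set.Ioo (0:ℝ) 1} → N'.IsRational → N.value = N'.value → Equivalent N N')
    {j : ℕ} (hj : j ≤ 5) (N : IntegralRep j) (hNd : N.domain = {x | ∀ i, x i ∈ Set.Ioo (0:ℝ) 1})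
    (hNr : N.IsRational) (hv : N.value = 0) : of N ∈ relations :=
  boxVanishing_le_five_of_boxVanishing_five (boxVanishing_five_of_stub_boxRigidity_var2288 h) hj N
    hNd hNr hv

/-! ## Upper bounds: the parent leaf and the Summit imply V2288 -/

/-- **The parent leaf ⇒ V2288** (both dimension bounds are simply dropped).
[cite: KontsevichZagier2001, §1.2 Conjecture 1] -/
theorem stub_boxRigidity_var2288_of_parent
    (h : ∀ (m m' : ℕ) (N : IntegralRep m) (N' : IntegralRep m'), N.domain = {x | ∀ i, x i ∈ Set.Ioo (0:ℝ) 1} → N.IsRational → N'.domain = {x | ∀ i, x i ∈ Set.Ioo (0:ℝ) 1} → N'.IsRational → N.value = N'.value → Equivalent N N') :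
    ∀ (m m' : ℕ) (N : IntegralRep m) (N' : IntegralRep m'), m' ≤ 3 → m ≤ 5 → N.domain = {x | ∀ i, x i ∈ Set.Ioo (0:ℝ) 1} → N.IsRational → N'.domain = {x | ∀ i, x i ∈ Set.Ioo (0:ℝ) 1} → N'.IsRational → N.value = N'.value → Equivalent N N' :=
  fun m m' N N' _ _ => h m m' N N'

/-- **`KontsevichZagierPeriods ⇒ V2288`**: the variant is a special case of Conjecture 1 for the tree's
calculus (`leaves_of_statement`) — so a refutation of the variant would refute the Summit.
[cite: KontsevichZagier2001, §1.2 Conjecture 1] -/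
theorem stub_boxRigidity_var2288_of_statement (h : _root_.KontsevichZagierPeriods) :
    ∀ (m m' : ℕ) (N : IntegralRep m) (N' : IntegralRep m'), m' ≤ 3 → m ≤ 5 → N.domain = {x | ∀ i, x i ∈ Set.Ioo (0:ℝ) 1} → N.IsRational → N'.domain = {x | ∀ i, x i ∈ Set.Ioo (0:ℝ) 1} → N'.IsRational → N.value = N'.value → Equivalent N N' :=
  stub_boxRigidity_var2288_of_parent (leaves_of_statement h).1

end Summit.KontsevichZagierPeriods.KontsevichZagierPeriods.Theorems

end
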